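import Summits.AtomisticToContinuum.FouriersLaw.Theorems.CoercivePulseLinearCeilingHelfandMoment
import HarnessLib

/-!
# Stub `stub_helfandIdentity` (H) of line `KaramataCollapse`
(crux `CoercivePulse.LinearSpread`, item stmt-AtomisticToContinuum-15382; `--supports` file, closes nothing)

WHAT. The registered infrastructure stub H of the crux skeleton: HELFAND'S IDENTITY IN THE TIME DOMAIN for the
Helfand moment `M(t) = Σ_x x² S(x,t)` of the energy pulse `S(x,t) = Cov_μ(h_0, h_x ∘ φ_t)` of the guarded infinite
pinned anharmonic chain `pinnedChain ω₂ lam β γ` (`ω₂, lam, β > 0`) in its shift- and momentum-reversal-invariant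
DLR state `μ` at `T > 0`, along ANY `μ`-preserving, a.e. shift-covariant dynamics `D`, under the guard
`Σ_x (1+x²)|S(x,t)| < ∞` at every `t`:
`M(t) − M(0) = 2 ∫_{(0,t]} (t − s) C_T(s) ds` for every `t ≥ 0`, with `C_T = D.currentCorrelation μ` the summed
current autocorrelation. This is the bridge between the crux's object `M` and the heat variance `V` on which the
rest of the line runs.

HOW. For `t > 0` this is, hypothesis for hypothesis, the landed tree theorem
`LinearCeiling.SpikeLemma.stub_helfandMoment` (`Theorems/CoercivePulseLinearCeilingHelfandMoment.lean`: the per-site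
twice-integrated conservation law `AbelSpreadCeiling.RegularityCollapse.stub_perSiteHelfand` summed against the
cut-off weights `c_L → x²` of the Abel-exchange toolkit, two summations by parts, Tannery in `x` and dominated
convergence in `u` under the window-uniform summable clustering majorant of the canonical Buttà–Marchioro twin).
The remaining case `t = 0` is trivial: the left side is `M(0) − M(0) = 0` and the right side is an integral over
`Ioc 0 0 = ∅`.
-/

noncomputable section

namespace Summit.AtomisticToContinuum.FouriersLaw.Theorems.LinearSpread.KaramataCollapse

open MeasureTheory ProbabilityTheory Filter Set Function
open Literature.MathematicalPhysics.KineticTheory.HeatConduction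

/-- **Stub `stub_helfandIdentity` (registered signature, verbatim): Helfand's identity for the Helfand moment in
the time domain**, `Σ_x x² S(x,t) − Σ_x x² S(x,0) = 2∫_{(0,t]} (t − s) C_T(s) ds` for every `t ≥ 0`, along ANY
`μ`-preserving a.e. shift-covariant dynamics of the pinned anharmonic chain in its shift- and reversal-invariant DLR
state at `T > 0`, under `Σ_x (1+x²)|S(x,t)| < ∞` at every `t`. The case `t > 0` is the landed
`LinearCeiling.SpikeLemma.stub_helfandMoment`; at `t = 0` both sides vanish.
[cite: Helfand1960, §II] [cite: BonettoLebowitzReyBellet2000, §6.3] -/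
theorem stub_helfandIdentity :
    ∀ ω₂ lam β γ : ℝ, 0 < ω₂ → 0 < lam → 0 < β → ∀ T : ℝ, 0 < T → ∀ μ : MeasureTheory.Measure Literature.MathematicalPhysics.KineticTheory.HeatConduction.ChainConfig, (Literature.MathematicalPhysics.KineticTheory.HeatConduction.pinnedChain ω₂ lam β γ).IsChainGibbsMeasure T μ → Literature.MathematicalPhysics.KineticTheory.HeatConduction.IsShiftInvariant μ → μ.map (fun σ : Literature.MathematicalPhysics.KineticTheory.HeatConduction.ChainConfig => fun x : ℤ => ((σ x).1, -(σ x).2)) = μ → ∀ D : Literature.MathematicalPhysics.KineticTheory.HeatConduction.InfiniteChainDynamics (Literature.MathematicalPhysics.KineticTheory.HeatConduction.pinnedChain ω₂ lam β γ), D.PreservesMeasure μ → (∀ t : ℝ, ∀ᵐ σ ∂μ, D.flow t (Literature.MathematicalPhysics.KineticTheory.HeatConduction.shift σ) = Literature.MathematicalPhysics.KineticTheory.HeatConduction.shift (D.flow t σ)) → ∀ h : Literature.MathematicalPhysics.KineticTheory.HeatConduction.ChainConfig → ℤ → ℝ, h = (fun (σ : Literature.MathematicalPhysics.KineticTheory.HeatConduction.ChainConfig)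 (x : ℤ) => (σ x).2 ^ 2 / 2 + (Literature.MathematicalPhysics.KineticTheory.HeatConduction.pinnedChain ω₂ lam β γ).U (σ x).1 + ((Literature.MathematicalPhysics.KineticTheory.HeatConduction.pinnedChain ω₂ lam β γ).V ((σ (x + 1)).1 - (σ x).1) + (Literature.MathematicalPhysics.KineticTheory.HeatConduction.pinnedChain ω₂ lam β γ).V ((σ x).1 - (σ (x - 1)).1)) / 2) → ∀ S : ℤ → ℝ → ℝ, S = (fun (x : ℤ) (t : ℝ) => ∫ σ, (h σ 0 - ∫ σ', h σ' 0 ∂μ) * (h (D.flow t σ) x - ∫ σ', h σ' 0 ∂μ) ∂μ) → (∀ t : ℝ, Summable (fun x : ℤ => (1 + (x : ℝ) ^ 2) * |S x t|)) → ∀ t : ℝ, 0 ≤ t → (∑' x : ℤ, (x : ℝ) ^ 2 * S x t) - (∑' x : ℤ, (x : ℝ) ^ 2 * S x 0) = 2 * ∫ s in Set.Ioc (0:ℝ) t, (t - s) * D.currentCorrelation μ s := by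
  intro ω₂ lam β γ hω hl hβ T hT μ hG hSI hR D hP hSh h hh S hS hSum t ht
  rcases ht.eq_or_lt with rfl | ht'
  · -- `t = 0`: both sides vanish (`Ioc 0 0 = ∅`)
    rw [sub_self, Set.Ioc_self, Measure.restrict_empty, integral_zero_measure, mul_zero]
  · -- `t > 0`: the landed Helfand identity for the Helfand moment
    exact Summit.AtomisticToContinuum.FouriersLaw.Theorems.LinearCeiling.SpikeLemma.stub_helfandMoment
      ω₂ lam β γ hω hl hβ T hT μ hG hSI hR D hP hSh h hh S hS hSum t ht'

end Summit.AtomisticToContinuum.FouriersLaw.Theorems.LinearSpread.KaramataCollapse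

end
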